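import Summits.QuantumFields.GaugeBoot.DiagonalRPTorusClosedHalfNegativeHighDim
import HarnessLib

/-!
# Closed-half diagonal RP fails on odd tori `(ℤ/L)^d`, `d ≥ 4`: clean concrete statements
(gauge-boot, task L3 sequel, odd case, supplement)

HONEST FRAMING (cell `pub-gaugeboot`, page 1 of every file): the venture produces certified bounds
on lattice expectations at stated coupling, gauge group, dimension and torus size; NOT a mass gap,
NOT a continuum limit, NOT a string tension; NOT Yang–Mills-summit-bearing (barriers
`FixedCouplingUltralocality`, `PerturbativeInvisibility`). This module is a structural NEGATIVE
result about which positivity constraints a TORUS certificate may use; it discharges nothing else.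

## Content

The concrete theorems `DiagRPTube.not_diagonalReflectionPositive_odd_suN_highDim` /
`_uN_highDim` of `DiagonalRPTorusClosedHalfNegativeHighDim` carry vacuous extra implicit binders
(an `omega` call inside their statements captured unrelated section variables). This supplement
restates them with CLEAN signatures, usable as `… hd hN hLodd h3`:

* **`not_diagonalReflectionPositive_odd_suN_highDim'`** — `SU(N)`, `N ≥ 2`: for every `d ≥ 4`
  and every odd `L ≥ 3` there is `β₀ > 0` with `¬ DiagonalReflectionPositive (d := d) (L := L)
  (fundamentalRep (Fin N)) β ⟨0, _⟩ ⟨1, _⟩` for all `0 < β ≤ β₀`;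
* **`not_diagonalReflectionPositive_odd_uN_highDim'`** — the same for `U(N)`, `N ≥ 1`.

Both are one-line applications of the abstract `_specialUnitary` / `_unitary` theorems (whose
signatures are clean). Elementary; no named fact.
-/

open MeasureTheory

namespace Summit.QuantumFields.GaugeBoot

open Literature.MathematicalPhysics.QuantumFieldTheory
open Literature.MathematicalPhysics.QuantumLattice
open Literature.RepresentationTheory.CompactGroups

noncomputable section

namespace DiagRPTube

/-- ★★ **`SU(N)` lattice gauge theory (`N ≥ 2`) violates closed-half diagonal RP on every odd
torus `(ℤ/L)^d`, `d ≥ 4`, `L ≥ 3`, for all sufficiently small `β > 0`** (mirror `x₀ = x₁`; clean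
signature). -/
theorem not_diagonalReflectionPositive_odd_suN_highDim' {d L N : ℕ} [NeZero L] (hd : 4 ≤ d)
    (hN : 2 ≤ N) (hLodd : Odd L) (h3 : 3 ≤ L) :
    ∃ β₀ : ℝ, 0 < β₀ ∧ ∀ β : ℝ, 0 < β → β ≤ β₀ →
      ¬ DiagonalReflectionPositive (d := d) (L := L) (fundamentalRep (Fin N)) β
        ⟨0, Nat.lt_of_lt_of_le (Nat.succ_pos 3) hd⟩
        ⟨1, Nat.lt_of_lt_of_le (Nat.lt_of_sub_eq_succ rfl) hd⟩ := by
  haveI : SecondCountableTopology (Matrix (Fin N) (Fin N) ℂ) :=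
    inferInstanceAs (SecondCountableTopology (Fin N → Fin N → ℂ))
  haveI : SecondCountableTopology (Matrix.specialUnitaryGroup (Fin N) ℂ) :=
    Topology.IsEmbedding.subtypeVal.secondCountableTopology
  have h2 : 2 < d := Nat.lt_of_lt_of_le (by decide) hd
  have h3' : 3 < d := Nat.lt_of_lt_of_le (by decide) hd
  have hij : (⟨0, Nat.lt_of_lt_of_le (Nat.succ_pos 3) hd⟩ : Fin d) <
      ⟨1, Nat.lt_of_lt_of_le (Nat.lt_of_sub_eq_succ rfl) hd⟩ := Fin.mk_lt_mk.2 (by decide)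
  have hjk : (⟨1, Nat.lt_of_lt_of_le (Nat.lt_of_sub_eq_succ rfl) hd⟩ : Fin d) < ⟨2, h2⟩ :=
    Fin.mk_lt_mk.2 (by decide)
  have hkl : (⟨2, h2⟩ : Fin d) < ⟨3, h3'⟩ := Fin.mk_lt_mk.2 (by decide)
  exact not_diagonalReflectionPositive_odd_highDim_specialUnitary (fundamentalRep (Fin N)) hij hjk hkl
    (TorusAreaLaw.isSpecialUnitaryModel_fundamentalRep N) hN hLodd h3

/-- ★★ **`U(N)` lattice gauge theory (`N ≥ 1`) violates closed-half diagonal RP on every odd torus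
`(ℤ/L)^d`, `d ≥ 4`, `L ≥ 3`, for all sufficiently small `β > 0`** (clean signature). -/
theorem not_diagonalReflectionPositive_odd_uN_highDim' {d L N : ℕ} [NeZero L] (hd : 4 ≤ d)
    (hN : 1 ≤ N) (hLodd : Odd L) (h3 : 3 ≤ L) :
    ∃ β₀ : ℝ, 0 < β₀ ∧ ∀ β : ℝ, 0 < β → β ≤ β₀ →
      ¬ DiagonalReflectionPositive (d := d) (L := L) (unitaryFundamentalRep (Fin N) ℂ) β
        ⟨0, Nat.lt_of_lt_of_le (Nat.succ_pos 3) hd⟩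
        ⟨1, Nat.lt_of_lt_of_le (Nat.lt_of_sub_eq_succ rfl) hd⟩ := by
  haveI : SecondCountableTopology (Matrix.unitaryGroup (Fin N) ℂ) :=
    IsUnitaryModel.secondCountableTopology _ (isUnitaryModel_unitaryFundamentalRep N)
  have h2 : 2 < d := Nat.lt_of_lt_of_le (by decide) hd
  have h3' : 3 < d := Nat.lt_of_lt_of_le (by decide) hd
  have hij : (⟨0, Nat.lt_of_lt_of_le (Nat.succ_pos 3) hd⟩ : Fin d) <
      ⟨1, Nat.lt_of_lt_of_le (Nat.lt_of_sub_eq_succ rfl) hd⟩ := Fin.mk_lt_mk.2 (by decide)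
  have hjk : (⟨1, Nat.lt_of_lt_of_le (Nat.lt_of_sub_eq_succ rfl) hd⟩ : Fin d) < ⟨2, h2⟩ :=
    Fin.mk_lt_mk.2 (by decide)
  have hkl : (⟨2, h2⟩ : Fin d) < ⟨3, h3'⟩ := Fin.mk_lt_mk.2 (by decide)
  exact not_diagonalReflectionPositive_odd_highDim_unitary (unitaryFundamentalRep (Fin N) ℂ) hij hjk hkl
    (isUnitaryModel_unitaryFundamentalRep N) hN hLodd h3

end DiagRPTube

end

end Summit.QuantumFields.GaugeBoot
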